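import Literature.NumberTheory.Automorphic.Liu2021.AppendixC.EtaleBettiComparison
import Literature.AlgebraicGeometry.Motives.AbelianVarietyTateModuleAlong
import Literature.AlgebraicGeometry.HodgeTheory.AbelianVarietyIntegralLattice
import Literature.AlgebraicTopology.SingularHomology.KroneckerDegreeOne
import Mathlib.LinearAlgebra.Dual.BaseChange
import Mathlib.RingTheory.TensorProduct.Free
import HarnessLib

/-!
# [SGA4 XI 4.4 / Lang VII §2 / Deligne 1982 §1] the degree-one comparison theorem for abelian varieties over
# `E ⊆_{τ'} ℂ` — PROOF of the named fact `exists_h1ComparisonFamily` of `EtaleBettiComparison`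

Topic `NumberTheory/Automorphic/Liu2021/AppendixC`; namespace `Literature.NumberTheory.Automorphic.Liu2021.AppendixC`.
Cell `hodgecm-mathlib` (D-0151), interface row VI-2″ / junction with `StubEtaleModel` (a3-liu418 v3): the named fact
`exists_h1ComparisonFamily τ' ℓ ι` (`EtaleBettiComparison.lean` §3, p595473: a NATURAL `ι`-semilinear bijection
`c_A : H¹((A ×_{E,τ'} ℂ)(ℂ); ℂ) → ℚ_ℓ^{ac} ⊗_{ℚ_ℓ} (V_ℓ A)^∨` for every abelian variety `A / E`) is PROVED here,
unconditionally, for every field `E`, every embedding `τ' : E →+* ℂ`, every prime `ℓ` and every `ι : ℂ ≃+* ℚ_ℓ^{ac}`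
(**`exists_h1ComparisonFamily_holds`**), by assembling pieces the tree already proves:

* (a) `T_ℓ(A) ≅ T_ℓ((A ×_E ℂ)(ℂ))` along an extension `\tilde τ' : Ē → ℂ` of `τ'` (all torsion points are
  algebraic; `Motives/AbelianVarietyTateModuleAlong`, `tateModulePointsEquiv`, natural in `A ⟶ B`);
* (b) Lang's `T_ℓ(V/D) = ℤ_ℓ ⊗_ℤ D`, `D = H₁(A_ℂ(ℂ); ℤ)` (`HodgeTheory/AbelianVarietyTateModuleHomology`:
  `hOneToTate`, `tateBasis`, Thm. 2.1 `tateModule_map_hOneToTate`) ⇒ `η_A : H₁ → T_ℓ A` and `H₁ → V_ℓ A` are BASE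
  CHANGES (Mathlib `IsBaseChange`) to `ℤ_ℓ`, `ℚ_ℓ` (`isBaseChange_eta`, `isBaseChange_etaQ`);
* (c) Kronecker duality in degree one `H¹(X; ℤ) ≅ Hom(H₁(X; ℤ), ℤ)` (`SingularHomology/KroneckerDegreeOne`, Hatcher
  Thm. 3.2) and Mathlib's `IsBaseChange.dual` ⇒ `δ_A : H¹((A_ℂ)(ℂ); ℤ) → (V_ℓ A)^∨`, `δ_A(z)(η c) = ⟨z, c⟩`, is a base
  change to `ℚ_ℓ` (`isBaseChange_delta`), hence `z ↦ 1 ⊗ δ_A z` one to `ℚ_ℓ^{ac}` (`isBaseChange_deltaBar`);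
* (c') the integral lattice `H¹((A_ℂ)(ℂ); ℤ) ⊂ H¹((A_ℂ)(ℂ); ℂ)` is a base change to `ℂ`
  (`HodgeTheory/AbelianVarietyIntegralLattice`: compatible cup-monomial bases; `isBaseChange_iota`);
* (d) two base changes `N₁ / S₁`, `N₂ / S₂` of ONE lattice `M` along a ring isomorphism `σ : S₁ ≃+* S₂` are related
  by a unique `σ`-semilinear bijection fixing `M` (`semilinearOfIsBaseChange`, §1) — with `S₁ = ℂ`, `S₂ = ℚ_ℓ^{ac}`,
  `σ = ι`, `M = H¹((A_ℂ)(ℂ); ℤ)` this IS `c_A` (`comparison`); naturality in `f : A ⟶ B` is checked on integral classes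
  (`LinearMap.ext_on`, `span_range_ringChange_int_eq_top`) where it is `⟨f^* z, c⟩ = ⟨z, f_* c⟩`
  (`kroneckerPairing_map`) and Thm. 2.1 (`delta_natural`).

Definitions with bodies and theorems only; NO new named fact; no instance, no notation, no `sorry`.  The
Galois-equivariance of `c_A` is not a field of `H1ComparisonFamily` and is not treated here.  HC_CM is proved
only modulo the 7 printed citations until rung 0 closes; this file discharges the Literature debt
`exists_h1ComparisonFamily` (+1 → 0), nothing of [Liu2021].

## References

* [SGA4Tome3] M. Artin, A. Grothendieck, J.-L. Verdier, SGA 4 Tome 3, Exp. XI Thm. 4.4.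
* [Lang1982AbelianFunctions] S. Lang, *Introduction to Algebraic and Abelian Functions*, 2nd ed. (1982), Ch. VII §2,
  (2) p. 116 and Thm. 2.1.
* [Deligne1982] P. Deligne, *Hodge cycles on abelian varieties*, LNM 900 (1982), §1 (`H_σ(X) ⊗ ℚ_ℓ ≅ H_ℓ(X)`).
* [HatcherAT2002] A. Hatcher, *Algebraic Topology* (2002), §3.1 Thm. 3.2, p. 198 (change of coefficients), p. 201.
* [Lange2023AbelianVarietiesComplex] H. Lange, *Abelian Varieties over the Complex Numbers* (2023), §1.1.3 (1.4).
* [Liu2021] Y. Liu, Camb. J. Math. 9 (2021), §4.3 l. 2154 («by the comparison theorem»).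
-/

noncomputable section

open CategoryTheory Function
open scoped TensorProduct

namespace Literature.NumberTheory.Automorphic.Liu2021.AppendixC

/-! ## §1 Algebra: base changes recognised on bases; two base changes along a ring isomorphism -/

namespace H1Comparison

section IntLinear

variable {M N : Type*} [AddCommGroup M] [AddCommGroup N] [Module ℤ M] [Module ℤ N]

/-- An additive homomorphism of abelian groups is `ℤ`-linear for ANY pair of `ℤ`-module structures (all
`ℤ`-module structures on an abelian group coincide, Mathlib `AddCommGroup.uniqueIntModule`; needed because the
tree's (co)homology groups carry the `ModuleCat ℤ` instance while Tate modules carry `AddCommGroup.toIntModule`).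
[cite: Lang2002, III §1 (abelian groups as ℤ-modules)] -/
def intLinear (f : M →+ N) : M →ₗ[ℤ] N where
  toFun := f
  map_add' := f.map_add
  map_smul' n x := by simpa only [Int.cast_id, RingHom.id_apply] using map_intCast_smul f ℤ ℤ n x

/-- `intLinear f = f` as functions. [cite: Lang2002, III §1 (abelian groups as ℤ-modules)] -/
@[simp]
theorem intLinear_apply (f : M →+ N) (x : M) : intLinear f x = f x := rfl

/-- An additive isomorphism of abelian groups is a `ℤ`-linear isomorphism for ANY pair of `ℤ`-module structures.
[cite: Lang2002, III §1 (abelian groups as ℤ-modules)] -/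
def intLinearEquiv (e : M ≃+ N) : M ≃ₗ[ℤ] N :=
  { e with map_smul' := (intLinear e.toAddMonoidHom).map_smul }

/-- `intLinearEquiv e = e` as functions. [cite: Lang2002, III §1 (abelian groups as ℤ-modules)] -/
@[simp]
theorem intLinearEquiv_apply (e : M ≃+ N) (x : M) : intLinearEquiv e x = e x := rfl

/-- `(intLinearEquiv e)⁻¹ = e⁻¹` as functions. [cite: Lang2002, III §1 (abelian groups as ℤ-modules)] -/
@[simp]
theorem intLinearEquiv_symm_apply (e : M ≃+ N) (y : N) : (intLinearEquiv e).symm y = e.symm y := rfl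

end IntLinear

section OfBasis

variable {R S M N ι : Type*} [CommRing R] [CommRing S] [Algebra R S] [AddCommGroup M] [Module R M]
  [AddCommGroup N] [Module R N] [Module S N] [IsScalarTower R S N]

/-- **A linear map sending an `R`-basis to an `S`-basis is a base change**: if `f (b i) = b' i` for an `R`-basis
`b` of `M` and an `S`-basis `b'` of `N`, then `N = S ⊗_R M` along `f` (Mathlib `IsBaseChange.of_equiv` with the
basis isomorphism `S ⊗_R M ≃ N`, `1 ⊗ b i ↦ b' i`). [cite: BourbakiAlgebraI1989, II §5.1 Prop. 4 (bases under extension of scalars)]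
[cite: Lang2002, XVI §4 (extension of the base)] -/
theorem isBaseChange_of_basis (f : M →ₗ[R] N) (b : Module.Basis ι R M) (b' : Module.Basis ι S N)
    (h : ∀ i, b' i = f (b i)) : IsBaseChange S f := by
  refine IsBaseChange.of_equiv ((Algebra.TensorProduct.basis S b).equiv b' (Equiv.refl ι)) fun x ↦ ?_
  suffices hx : (((Algebra.TensorProduct.basis S b).equiv b' (Equiv.refl ι)).toLinearMap.restrictScalars R ∘ₗ
      TensorProduct.mk R S M 1) = f from LinearMap.congr_fun hx x
  refine b.ext fun i ↦ ?_
  rw [LinearMap.comp_apply, LinearMap.coe_restrictScalars, TensorProduct.mk_apply, LinearEquiv.coe_toLinearMap,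
    ← Algebra.TensorProduct.basis_apply, Module.Basis.equiv_apply, Equiv.refl_apply, h]

end OfBasis

section Semilinear

-- The `ℤ`-module structures are PARAMETERS (not derived from `AddCommGroup`): the tree's (co)homology groups
-- carry the `ModuleCat ℤ` instance, and unifying it with `AddCommGroup.toIntModule` must be avoided.
variable {M : Type*} [AddCommGroup M] [Module ℤ M] (ℓ : ℕ) [Fact ℓ.Prime]
  {N₁ : Type*} [AddCommGroup N₁] [Module ℂ N₁] {N₂ : Type*} [AddCommGroup N₂] [Module (AlgebraicClosure ℚ_[ℓ]) N₂]

variable (M) in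
/-- `σ ⊗ 1 : ℂ ⊗_ℤ M ≃ ℚ_ℓ^{ac} ⊗_ℤ M` for a ring isomorphism `σ : ℂ ≃+* ℚ_ℓ^{ac}` (Mathlib `TensorProduct.congr`),
additive.  (Stated for the concrete pair `ℂ`, `ℚ_ℓ^{ac}` of [Liu2021] §4.3 so that all instances are the canonical
ones.) [cite: BourbakiAlgebraI1989, II §5.1 (extension of scalars along a ring homomorphism)] -/
def tensorCongrLeft (σ : ℂ ≃+* AlgebraicClosure ℚ_[ℓ]) : ℂ ⊗[ℤ] M ≃ₗ[ℤ] AlgebraicClosure ℚ_[ℓ] ⊗[ℤ] M :=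
  TensorProduct.congr σ.toAddEquiv.toIntLinearEquiv (LinearEquiv.refl ℤ M)

/-- `(σ ⊗ 1)(s ⊗ m) = σ s ⊗ m`. [cite: BourbakiAlgebraI1989, II §5.1 (extension of scalars along a ring homomorphism)] -/
@[simp]
theorem tensorCongrLeft_tmul (σ : ℂ ≃+* AlgebraicClosure ℚ_[ℓ]) (s : ℂ) (m : M) :
    tensorCongrLeft M ℓ σ (s ⊗ₜ m) = σ s ⊗ₜ m := rfl

/-- `σ ⊗ 1` is `σ`-semilinear: `(σ ⊗ 1)(c • t) = σ c • (σ ⊗ 1) t`. [cite: BourbakiAlgebraI1989, II §5.1 (extension of scalars along a ring homomorphism)] -/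
theorem tensorCongrLeft_smul (σ : ℂ ≃+* AlgebraicClosure ℚ_[ℓ]) (c : ℂ) (t : ℂ ⊗[ℤ] M) :
    tensorCongrLeft M ℓ σ (c • t) = σ c • tensorCongrLeft M ℓ σ t := by
  induction t using TensorProduct.induction_on with
  | zero => rw [smul_zero, map_zero, smul_zero]
  | tmul s m => rw [TensorProduct.smul_tmul', tensorCongrLeft_tmul, tensorCongrLeft_tmul, TensorProduct.smul_tmul',
      smul_eq_mul, smul_eq_mul, map_mul]
  | add x y hx hy => rw [smul_add, map_add, hx, hy, map_add, smul_add]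

variable {j₁ : M →ₗ[ℤ] N₁} {j₂ : M →ₗ[ℤ] N₂} (h₁ : IsBaseChange ℂ j₁) (h₂ : IsBaseChange (AlgebraicClosure ℚ_[ℓ]) j₂)
  (σ : ℂ ≃+* AlgebraicClosure ℚ_[ℓ])

/-- **Two base changes of one lattice along `σ : ℂ ≃+* ℚ_ℓ^{ac}`.**  For a `ℤ`-module `M` and base changes
`j₁ : M → N₁` to `ℂ` and `j₂ : M → N₂` to `ℚ_ℓ^{ac}`: the `σ`-SEMILINEAR map `N₁ = ℂ ⊗ M →(σ ⊗ 1) ℚ_ℓ^{ac} ⊗ M = N₂`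
(Mathlib `IsBaseChange.equiv`) — «`⊗_{ℂ,ι_ℓ} ℚ_ℓ^{ac}`». [cite: Liu2021, §4.3 l. 2154] -/
def semilinearOfIsBaseChange : N₁ →ₛₗ[(σ : ℂ →+* AlgebraicClosure ℚ_[ℓ])] N₂ where
  toFun x := h₂.equiv (tensorCongrLeft M ℓ σ (h₁.equiv.symm x))
  map_add' x y := by rw [map_add, map_add, map_add]
  map_smul' c x := by rw [LinearEquiv.map_smul, tensorCongrLeft_smul, LinearEquiv.map_smul, RingHom.coe_coe]

/-- Unfolding of `semilinearOfIsBaseChange`. [cite: BourbakiAlgebraI1989, II §5.1 (extension of scalars along a ring homomorphism)] -/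
theorem semilinearOfIsBaseChange_apply (x : N₁) :
    semilinearOfIsBaseChange ℓ h₁ h₂ σ x = h₂.equiv (tensorCongrLeft M ℓ σ (h₁.equiv.symm x)) := rfl

/-- **The comparison fixes the lattice**: `Θ (j₁ m) = j₂ m`. [cite: BourbakiAlgebraI1989, II §5.1 Prop. 1 (universal property of extension of scalars)] -/
@[simp]
theorem semilinearOfIsBaseChange_comp_apply (m : M) : semilinearOfIsBaseChange ℓ h₁ h₂ σ (j₁ m) = j₂ m := by
  rw [semilinearOfIsBaseChange_apply, IsBaseChange.equiv_symm_apply, tensorCongrLeft_tmul, map_one,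
    IsBaseChange.equiv_tmul, one_smul]

/-- **The comparison is a bijection** (a composite of three bijections). [cite: BourbakiAlgebraI1989, II §5.1 (extension of scalars along a ring homomorphism)] -/
theorem semilinearOfIsBaseChange_bijective : Bijective (semilinearOfIsBaseChange ℓ h₁ h₂ σ) :=
  h₂.equiv.bijective.comp ((tensorCongrLeft M ℓ σ).bijective.comp h₁.equiv.symm.bijective)

end Semilinear

end H1Comparison

namespace H1Comparison

open Literature.AlgebraicGeometry.Motives (AbelianVariety AlgPoints ComplexPoints)
open Literature.AlgebraicGeometry.Motives.AbelianVariety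
open Literature.AlgebraicGeometry.HodgeTheory (complexBetti)
open Literature.AlgebraicGeometry.HodgeTheory.AbelianVariety (hOneToTate tateBasis tateBasis_apply
  nonempty_singularHomology_one_addEquiv_pi tateModule_map_hOneToTate pointsAddMonoidHom
  free_singularHomology_int finite_singularHomology_int exists_basis_ringChange_int_eq span_range_ringChange_int_eq_top)
open Literature.AlgebraicTopology.SingularHomology
open Literature.NumberTheory.EllipticCurves (TateModule RationalTateModule)

variable {E : Type} [Field E] [Algebra E ℂ] (ℓ : ℕ) [Fact ℓ.Prime] (A : AbelianVariety E) {B : AbelianVariety E}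

/-! ## §2 `H¹((A ×_E ℂ)(ℂ); ℂ) = ℂ ⊗_ℤ H¹((A ×_E ℂ)(ℂ); ℤ)` -/

/-- **`ι_A : H¹((A ×_E ℂ)(ℂ); ℤ) → H¹((A ×_E ℂ)(ℂ); ℂ)`**, the change of coefficients `ℤ → ℂ` (the tree's
`singularCohomology.ringChange`), as a `ℤ`-linear map. [cite: HatcherAT2002, §3.1 p. 198] -/
def iota : singularCohomology ℤ ℤ ((A.baseChange ℂ).Points ℂ) 1 →ₗ[ℤ] complexBetti (A.baseChange ℂ).X 1 :=
  intLinear (singularCohomology.ringChange (Int.castRingHom ℂ) ((A.baseChange ℂ).Points ℂ) 1)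

/-- Unfolding of `iota`. [cite: HatcherAT2002, §3.1 p. 198] -/
theorem iota_apply (z : singularCohomology ℤ ℤ ((A.baseChange ℂ).Points ℂ) 1) :
    iota A z = singularCohomology.ringChange (Int.castRingHom ℂ) ((A.baseChange ℂ).Points ℂ) 1 z := rfl

/-- **The integral lattice is a full lattice: `H¹((A ×_E ℂ)(ℂ); ℂ) = ℂ ⊗_ℤ H¹((A ×_E ℂ)(ℂ); ℤ)` along `ι_A`**
(compatible cup-monomial bases over `ℤ` and `ℂ`, `exists_basis_ringChange_int_eq`).
[cite: Lange2023AbelianVarietiesComplex, §1.1.3 (PDF p. 23)] [cite: HatcherAT2002, §3.2 Example 3.16] -/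
theorem isBaseChange_iota : IsBaseChange ℂ (iota A) := by
  obtain ⟨bZ, bC, hb⟩ := exists_basis_ringChange_int_eq (A.baseChange ℂ) ℂ 1
  exact isBaseChange_of_basis (iota A) bZ bC fun s ↦ (hb s).symm

variable {A} in
/-- Naturality of `ι`: `(f_ℂ)^* (ι_B z) = ι_A ((f_ℂ)^* z)` (`singularCohomology.ringChange_map`). [cite: HatcherAT2002, §3.1 p. 198] -/
theorem map_iota (f : A ⟶ B) (z : singularCohomology ℤ ℤ ((B.baseChange ℂ).Points ℂ) 1) :
    (singularCohomology.map ℂ ℂ (AlgPoints.mapContinuous (L := ℂ) (Hom.baseChange ℂ f).hom.hom.hom) 1).hom (iota B z) =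
      iota A ((singularCohomology.map ℤ ℤ (AlgPoints.mapContinuous (L := ℂ) (Hom.baseChange ℂ f).hom.hom.hom) 1).hom z) := by
  rw [iota_apply, iota_apply, singularCohomology.ringChange_map]


/-! ## §3 The lattices `H₁((A ×_E ℂ)(ℂ); ℤ) → T_ℓ A → V_ℓ A` are base changes -/

variable [Algebra (AlgebraicClosure E) ℂ] [IsScalarTower E (AlgebraicClosure E) ℂ]

/-- **`η_A : H₁((A ×_E ℂ)(ℂ); ℤ) → T_ℓ A`**: Lang's `D → T_ℓ(V/D)` (`hOneToTate` of `A ×_E ℂ`) read in the algebraic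
Tate module of `A / E` through `T_ℓ(A) ≅ T_ℓ((A ×_E ℂ)(ℂ))` (`tateModulePointsEquiv`, leg VI-2″).
[cite: Lang1982AbelianFunctions, Ch. VII §2, (2), p. 116] -/
def eta : singularHomology ℤ ℤ ((A.baseChange ℂ).Points ℂ) 1 →ₗ[ℤ] A.tateModule ℓ :=
  ((A.tateModulePointsEquiv ℓ).symm.toLinearMap.restrictScalars ℤ) ∘ₗ intLinear (hOneToTate (A.baseChange ℂ) ℓ)

/-- Unfolding: `η_A c = e_A⁻¹ (hOneToTate c)`. [cite: Lang1982AbelianFunctions, Ch. VII §2, (2), p. 116] -/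
theorem eta_apply (c : singularHomology ℤ ℤ ((A.baseChange ℂ).Points ℂ) 1) :
    eta ℓ A c = (A.tateModulePointsEquiv ℓ).symm (hOneToTate (A.baseChange ℂ) ℓ c) := rfl

/-- **`T_ℓ A = ℤ_ℓ ⊗_ℤ H₁((A ×_E ℂ)(ℂ); ℤ)` along `η_A`** (Lang's (2): a `ℤ`-basis of `H₁` goes to the `ℤ_ℓ`-basis
`tateBasis` of `T_ℓ`). [cite: Lang1982AbelianFunctions, Ch. VII §2, (2), p. 116] [cite: MumfordAV1970, §19 p. 171] -/
theorem isBaseChange_eta : IsBaseChange ℤ_[ℓ] (eta ℓ A) := by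
  obtain ⟨e⟩ := nonempty_singularHomology_one_addEquiv_pi (A.baseChange ℂ)
  refine isBaseChange_of_basis (eta ℓ A) ((Pi.basisFun ℤ _).map (intLinearEquiv e).symm)
    ((tateBasis (A.baseChange ℂ) ℓ e).map (A.tateModulePointsEquiv ℓ).symm) fun i ↦ ?_
  rw [Module.Basis.map_apply, tateBasis_apply, Module.Basis.map_apply, Pi.basisFun_apply, eta_apply,
    intLinearEquiv_symm_apply]

variable {A} in
/-- **Naturality of `η`**: `T_ℓ(f) (η_A c) = η_B ((f_ℂ)_* c)` for `f : A ⟶ B` — Lang's Thm. 2.1 (the `ℓ`-adic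
representation restricted to `D` is the rational representation) transported along leg VI-2″.
[cite: Lang1982AbelianFunctions, Ch. VII §2, Thm. 2.1, p. 116] -/
theorem tateModuleMap_eta (f : A ⟶ B) (c : singularHomology ℤ ℤ ((A.baseChange ℂ).Points ℂ) 1) :
    tateModuleMap ℓ f (eta ℓ A c) =
      eta ℓ B ((singularHomology.map ℤ ℤ (AlgPoints.mapContinuous (L := ℂ) (Hom.baseChange ℂ f).hom.hom.hom) 1).hom c) := by
  rw [eta_apply, eta_apply, LinearEquiv.eq_symm_apply, tateModulePointsEquiv_tateModuleMap,
    LinearEquiv.apply_symm_apply, tateModule_map_hOneToTate]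

/-- **`η̃_A : H₁((A ×_E ℂ)(ℂ); ℤ) → V_ℓ A`**, `c ↦ 1 ⊗ η_A c`. [cite: Lang1982AbelianFunctions, Ch. VII §2, p. 116] -/
def etaQ : singularHomology ℤ ℤ ((A.baseChange ℂ).Points ℂ) 1 →ₗ[ℤ] A.rationalTateModule ℓ :=
  ((TateModule.toRational ℓ : A.tateModule ℓ →ₗ[ℤ_[ℓ]] A.rationalTateModule ℓ).restrictScalars ℤ) ∘ₗ eta ℓ A

/-- Unfolding: `η̃_A c = toRational (η_A c)`. [cite: Lang1982AbelianFunctions, Ch. VII §2, p. 116] -/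
theorem etaQ_apply (c : singularHomology ℤ ℤ ((A.baseChange ℂ).Points ℂ) 1) :
    etaQ ℓ A c = TateModule.toRational ℓ (eta ℓ A c) := rfl

/-- `V_ℓ = ℚ_ℓ ⊗_{ℤ_ℓ} T_ℓ` along `toRational` (by definition of the tree's `RationalTateModule`; Mathlib
`TensorProduct.isBaseChange`). [cite: MumfordAV1970, §19 p. 172] -/
theorem isBaseChange_toRational (M : Type) [AddCommGroup M] :
    IsBaseChange ℚ_[ℓ] (TateModule.toRational ℓ : TateModule M ℓ →ₗ[ℤ_[ℓ]] RationalTateModule M ℓ) :=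
  TensorProduct.isBaseChange ℤ_[ℓ] (TateModule M ℓ) ℚ_[ℓ]

/-- **`V_ℓ A = ℚ_ℓ ⊗_ℤ H₁((A ×_E ℂ)(ℂ); ℤ)` along `η̃_A`** (transitivity of base change).
[cite: Lang1982AbelianFunctions, Ch. VII §2, (2), p. 116] [cite: MumfordAV1970, §19 p. 172] -/
theorem isBaseChange_etaQ : IsBaseChange ℚ_[ℓ] (etaQ ℓ A) :=
  IsBaseChange.comp (isBaseChange_eta ℓ A) (isBaseChange_toRational ℓ A.geomPoints)

variable {A} in
/-- Naturality of `η̃`: `V_ℓ(f) (η̃_A c) = η̃_B ((f_ℂ)_* c)`. [cite: Lang1982AbelianFunctions, Ch. VII §2, Thm. 2.1, p. 116] -/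
theorem rationalTateModuleMap_etaQ (f : A ⟶ B) (c : singularHomology ℤ ℤ ((A.baseChange ℂ).Points ℂ) 1) :
    rationalTateModuleMap ℓ f (etaQ ℓ A c) =
      etaQ ℓ B ((singularHomology.map ℤ ℤ (AlgPoints.mapContinuous (L := ℂ) (Hom.baseChange ℂ f).hom.hom.hom) 1).hom c) := by
  rw [etaQ_apply, etaQ_apply, rationalTateModuleMap_toRational, tateModuleMap_eta]

/-! ## §4 `H¹((A ×_E ℂ)(ℂ); ℤ) → (V_ℓ A)^∨` and `→ ℚ_ℓ^{ac} ⊗ (V_ℓ A)^∨` are base changes -/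

/-- **Kronecker duality in degree one**, `H¹(X; ℤ) ≃ Hom(H₁(X; ℤ), ℤ)` (the tree's `kroneckerPairing_one_bijective`,
Hatcher Thm. 3.2). [cite: HatcherAT2002, §3.1 Thm. 3.2] [cite: Lange2023AbelianVarietiesComplex, §1.1.3 (1.4) (PDF p. 23)] -/
def kroneckerEquivOne (X : Type) [TopologicalSpace X] :
    singularCohomology ℤ ℤ X 1 ≃ₗ[ℤ] Module.Dual ℤ (singularHomology ℤ ℤ X 1) :=
  LinearEquiv.ofBijective (kroneckerPairing ℤ ℤ X 1) (kroneckerPairing_one_bijective (X := X) ℤ)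

/-- `kroneckerEquivOne z c = ⟨z, c⟩`. [cite: HatcherAT2002, §3.1 Thm. 3.2] -/
@[simp]
theorem kroneckerEquivOne_apply {X : Type} [TopologicalSpace X] (z : singularCohomology ℤ ℤ X 1)
    (c : singularHomology ℤ ℤ X 1) : kroneckerEquivOne X z c = kroneckerPairing ℤ ℤ X 1 z c := rfl

/-- **`δ_A : H¹((A ×_E ℂ)(ℂ); ℤ) → (V_ℓ A)^∨`**: the integral class `z` goes to the unique `ℚ_ℓ`-linear form on
`V_ℓ A = ℚ_ℓ ⊗ H₁` extending `c ↦ ⟨z, c⟩` (Mathlib `IsBaseChange.toDual` of `η̃_A`, after Kronecker duality).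
[cite: Lang1982AbelianFunctions, Ch. VII §2, (2), p. 116] [cite: HatcherAT2002, §3.1 Thm. 3.2] -/
def delta : singularCohomology ℤ ℤ ((A.baseChange ℂ).Points ℂ) 1 →ₗ[ℤ] Module.Dual ℚ_[ℓ] (A.rationalTateModule ℓ) :=
  (isBaseChange_etaQ ℓ A).toDual ∘ₗ (kroneckerEquivOne ((A.baseChange ℂ).Points ℂ)).toLinearMap

/-- **`δ_A(z)(η̃_A c) = ⟨z, c⟩`**. [cite: HatcherAT2002, §3.1 Thm. 3.2] -/
@[simp]
theorem delta_apply_etaQ (z : singularCohomology ℤ ℤ ((A.baseChange ℂ).Points ℂ) 1)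
    (c : singularHomology ℤ ℤ ((A.baseChange ℂ).Points ℂ) 1) :
    delta ℓ A z (etaQ ℓ A c) = (kroneckerPairing ℤ ℤ ((A.baseChange ℂ).Points ℂ) 1 z c : ℤ) := by
  rw [delta, LinearMap.comp_apply, LinearEquiv.coe_toLinearMap, IsBaseChange.toDual_comp_apply,
    kroneckerEquivOne_apply, algebraMap_int_eq, eq_intCast]

/-- **`(V_ℓ A)^∨ = ℚ_ℓ ⊗_ℤ H¹((A ×_E ℂ)(ℂ); ℤ)` along `δ_A`** (Mathlib `IsBaseChange.dual`: for a finite free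
lattice, taking duals commutes with base change; `H₁` is free of rank `2 dim A`).
[cite: Lange2023AbelianVarietiesComplex, §1.1.3 (1.4) (PDF p. 23)] [cite: MumfordAV1970, §19 p. 172] -/
theorem isBaseChange_delta : IsBaseChange ℚ_[ℓ] (delta ℓ A) := by
  haveI : Module.Free ℤ (singularHomology ℤ ℤ ((A.baseChange ℂ).Points ℂ) 1) :=
    free_singularHomology_int (A.baseChange ℂ) 1
  haveI : Module.Finite ℤ (singularHomology ℤ ℤ ((A.baseChange ℂ).Points ℂ) 1) :=
    finite_singularHomology_int (A.baseChange ℂ) 1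
  exact IsBaseChange.comp_equiv (kroneckerEquivOne ((A.baseChange ℂ).Points ℂ)) _ (isBaseChange_etaQ ℓ A).dual

variable {A} in
/-- **Naturality of `δ`: `δ_A(f^* z) = δ_B(z) ∘ V_ℓ(f)`** for `f : A ⟶ B` — on `η̃_A(H₁)` (which generates `V_ℓ A`)
this is `⟨f^* z, c⟩ = ⟨z, f_* c⟩` (`kroneckerPairing_map`) and Thm. 2.1 (`rationalTateModuleMap_etaQ`).
[cite: HatcherAT2002, §3.1 p. 201 (naturality of h)] [cite: Lang1982AbelianFunctions, Ch. VII §2, Thm. 2.1, p. 116] -/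
theorem delta_natural (f : A ⟶ B) (z : singularCohomology ℤ ℤ ((B.baseChange ℂ).Points ℂ) 1) :
    delta ℓ A ((singularCohomology.map ℤ ℤ (AlgPoints.mapContinuous (L := ℂ) (Hom.baseChange ℂ f).hom.hom.hom) 1).hom z) =
      (delta ℓ B z) ∘ₗ rationalTateModuleMap ℓ f := by
  refine (isBaseChange_etaQ ℓ A).algHom_ext _ _ fun c ↦ ?_
  rw [delta_apply_etaQ, LinearMap.comp_apply, rationalTateModuleMap_etaQ, delta_apply_etaQ, kroneckerPairing_map]

/-- **`z ↦ 1 ⊗ δ_A z : H¹((A ×_E ℂ)(ℂ); ℤ) → ℚ_ℓ^{ac} ⊗_{ℚ_ℓ} (V_ℓ A)^∨`**. [cite: Liu2021, §4.3 l. 2154] -/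
def deltaBar : singularCohomology ℤ ℤ ((A.baseChange ℂ).Points ℂ) 1 →ₗ[ℤ]
    AlgebraicClosure ℚ_[ℓ] ⊗[ℚ_[ℓ]] Module.Dual ℚ_[ℓ] (A.rationalTateModule ℓ) :=
  ((TensorProduct.mk ℚ_[ℓ] (AlgebraicClosure ℚ_[ℓ]) (Module.Dual ℚ_[ℓ] (A.rationalTateModule ℓ)) 1).restrictScalars ℤ)
    ∘ₗ delta ℓ A

/-- `deltaBar z = 1 ⊗ δ_A z`. [cite: Liu2021, §4.3 l. 2154] -/
@[simp]
theorem deltaBar_apply (z : singularCohomology ℤ ℤ ((A.baseChange ℂ).Points ℂ) 1) :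
    deltaBar ℓ A z = (1 : AlgebraicClosure ℚ_[ℓ]) ⊗ₜ delta ℓ A z := rfl

/-- **`ℚ_ℓ^{ac} ⊗ (V_ℓ A)^∨ = ℚ_ℓ^{ac} ⊗_ℤ H¹((A ×_E ℂ)(ℂ); ℤ)` along `z ↦ 1 ⊗ δ_A z`** (transitivity of base change).
[cite: Deligne1982, §1 (H_σ ⊗ ℚ_ℓ ≅ H_ℓ)] -/
theorem isBaseChange_deltaBar : IsBaseChange (AlgebraicClosure ℚ_[ℓ]) (deltaBar ℓ A) :=
  IsBaseChange.comp (isBaseChange_delta ℓ A)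
    (TensorProduct.isBaseChange ℚ_[ℓ] (Module.Dual ℚ_[ℓ] (A.rationalTateModule ℓ)) (AlgebraicClosure ℚ_[ℓ]))

/-! ## §5 The comparison `c_A` and the theorem -/

variable (ι : ℂ ≃+* AlgebraicClosure ℚ_[ℓ])

/-- **The comparison `c_A : H¹((A ×_E ℂ)(ℂ); ℂ) → ℚ_ℓ^{ac} ⊗_{ℚ_ℓ} (V_ℓ A)^∨`**, `ι`-semilinear: the two base
changes `ι_A` (to `ℂ`) and `z ↦ 1 ⊗ δ_A z` (to `ℚ_ℓ^{ac}`) of the lattice `H¹((A ×_E ℂ)(ℂ); ℤ)`, compared along `ι`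
(`semilinearOfIsBaseChange`).  «`H¹_ét(A_K ⊗_{E,τ'} ℂ, ℚ_ℓ^{ac}) ≃ H¹_{B,τ'}(A_K, ℂ) ⊗_{ℂ,ι_ℓ} ℚ_ℓ^{ac}` by the
comparison theorem». [cite: Liu2021, §4.3 l. 2154] [cite: SGA4Tome3, Exp. XI Thm. 4.4] [cite: Deligne1982, §1] -/
def comparison : complexBetti (A.baseChange ℂ).X 1 →ₛₗ[(ι : ℂ →+* AlgebraicClosure ℚ_[ℓ])]
    AlgebraicClosure ℚ_[ℓ] ⊗[ℚ_[ℓ]] Module.Dual ℚ_[ℓ] (A.rationalTateModule ℓ) :=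
  semilinearOfIsBaseChange ℓ (isBaseChange_iota A) (isBaseChange_deltaBar ℓ A) ι

/-- **On integral classes `c_A(ι_A z) = 1 ⊗ δ_A z`.** [cite: Deligne1982, §1] -/
@[simp]
theorem comparison_iota (z : singularCohomology ℤ ℤ ((A.baseChange ℂ).Points ℂ) 1) :
    comparison ℓ A ι (iota A z) = (1 : AlgebraicClosure ℚ_[ℓ]) ⊗ₜ delta ℓ A z :=
  (semilinearOfIsBaseChange_comp_apply ℓ (isBaseChange_iota A) (isBaseChange_deltaBar ℓ A) ι z).trans
    (deltaBar_apply ℓ A z)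

/-- **`c_A` is a bijection.** [cite: SGA4Tome3, Exp. XI Thm. 4.4] [cite: Deligne1982, §1] -/
theorem comparison_bijective : Bijective (comparison ℓ A ι) :=
  semilinearOfIsBaseChange_bijective ℓ _ _ _

variable {A} in
/-- **`c` is natural in homomorphisms over `E`: `c_A ((f_ℂ)^* y) = (1 ⊗ (V_ℓ f)^∨) (c_B y)`** — both sides are
`ι`-semilinear in `y` and agree on the integral classes `ι_B z`, which span (`span_range_ringChange_int_eq_top`),
where the identity is `δ_A((f_ℂ)^* z) = δ_B(z) ∘ V_ℓ(f)` (`delta_natural`).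
[cite: Deligne1982, §1] [cite: Lang1982AbelianFunctions, Ch. VII §2, Thm. 2.1, p. 116] [cite: HatcherAT2002, §3.1 p. 201] -/
theorem comparison_natural (f : A ⟶ B) (y : complexBetti (B.baseChange ℂ).X 1) :
    comparison ℓ A ι ((singularCohomology.map ℂ ℂ (AlgPoints.mapContinuous (L := ℂ) (Hom.baseChange ℂ f).hom.hom.hom) 1).hom y) =
      ((rationalTateModuleMap ℓ f).dualMap).baseChange (AlgebraicClosure ℚ_[ℓ]) (comparison ℓ B ι y) := by
  have key : (comparison ℓ A ι).comp
        (singularCohomology.map ℂ ℂ (AlgPoints.mapContinuous (L := ℂ) (Hom.baseChange ℂ f).hom.hom.hom) 1).hom =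
      (((rationalTateModuleMap ℓ f).dualMap).baseChange (AlgebraicClosure ℚ_[ℓ])).comp (comparison ℓ B ι) := by
    refine LinearMap.ext_on (span_range_ringChange_int_eq_top (B.baseChange ℂ) ℂ 1) ?_
    rintro _ ⟨z, rfl⟩
    change comparison ℓ A ι ((singularCohomology.map ℂ ℂ _ 1).hom (iota B z)) =
      ((rationalTateModuleMap ℓ f).dualMap).baseChange (AlgebraicClosure ℚ_[ℓ]) (comparison ℓ B ι (iota B z))
    rw [map_iota, comparison_iota, comparison_iota, LinearMap.baseChange_tmul, LinearMap.dualMap_apply', delta_natural]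
  exact LinearMap.congr_fun key y

end H1Comparison

/-! ## §6 The named fact `exists_h1ComparisonFamily` HOLDS -/

section Holds

open Literature.AlgebraicGeometry.Motives (AbelianVariety)

variable {E : Type} [Field E]

/-- **The comparison family along `(τ', ℓ, ι)`** — DATA: for every abelian variety `A / E` the `ι`-semilinear
bijection `c_A : H¹((A ×_{E,τ'} ℂ)(ℂ); ℂ) → ℚ_ℓ^{ac} ⊗_{ℚ_ℓ} (V_ℓ A)^∨` of §5, natural in `A ⟶ B`, for the
`E`-algebra structure `τ'` on `ℂ` and a chosen extension `Ē → ℂ` of `τ'` (`IsAlgClosed.lift`).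
[cite: SGA4Tome3, Exp. XI Thm. 4.4] [cite: Lang1982AbelianFunctions, Ch. VII §2, p. 115] [cite: Deligne1982, §1] -/
def h1ComparisonFamilyAlong (τ' : E →+* ℂ) (ℓ : ℕ) [Fact ℓ.Prime] (ι : ℂ ≃+* AlgebraicClosure ℚ_[ℓ]) :
    H1ComparisonFamily (E := E) τ' ℓ ι :=
  letI : Algebra E ℂ := algebraAlong E τ'
  letI : Algebra (AlgebraicClosure E) ℂ := (AbelianVariety.algebraicClosureAlgHom E).toRingHom.toAlgebra
  haveI : IsScalarTower E (AlgebraicClosure E) ℂ :=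
    IsScalarTower.of_algebraMap_eq fun x ↦ ((AbelianVariety.algebraicClosureAlgHom E).commutes x).symm
  { cmp := fun A ↦ H1Comparison.comparison ℓ A ι
    bijective := fun A ↦ H1Comparison.comparison_bijective ℓ A ι
    natural := fun f y ↦ H1Comparison.comparison_natural ℓ ι f y }

/-- **[SGA4 XI 4.4 / Lang VII §2 / Deligne 1982 §1] the degree-one comparison theorem for abelian varieties over
`E ⊆_{τ'} ℂ` HOLDS**: the named fact `exists_h1ComparisonFamily τ' ℓ ι` of `EtaleBettiComparison` (a natural
`ι`-semilinear comparison family `H¹((A ×_{E,τ'} ℂ)(ℂ); ℂ) ≅ ℚ_ℓ^{ac} ⊗ (V_ℓ A)^∨`) is a THEOREM, for every field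
`E`, embedding `τ'`, prime `ℓ` and `ι : ℂ ≃+* ℚ_ℓ^{ac}` — discharging the Betti-comparison half of
`Sec42Data.exists_etaleHeckeDatum_with_bettiComparison` (row VI-2″ of the cell `hodgecm-mathlib`).
[cite: SGA4Tome3, Exp. XI Thm. 4.4] [cite: DeligneSGA4half1977, Arcata V Thm. 3.1 and (3.5)]
[cite: Lang1982AbelianFunctions, Ch. VII §2, p. 115] [cite: Deligne1982, §1] -/
theorem exists_h1ComparisonFamily_holds (τ' : E →+* ℂ) (ℓ : ℕ) [Fact ℓ.Prime]
    (ι : ℂ ≃+* AlgebraicClosure ℚ_[ℓ]) : exists_h1ComparisonFamily (E := E) τ' ℓ ι :=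
  ⟨h1ComparisonFamilyAlong τ' ℓ ι⟩

end Holds

/-- **The same, universally closed** (no binders, no hypotheses: the data `(E, τ', ℓ, ι)` of the named fact are
quantified, nothing else): for EVERY field `E`, embedding `τ' : E →+* ℂ`, prime `ℓ` and `ι : ℂ ≃+* ℚ_ℓ^{ac}` the
comparison family exists. [cite: SGA4Tome3, Exp. XI Thm. 4.4] [cite: Lang1982AbelianFunctions, Ch. VII §2, p. 115]
[cite: Deligne1982, §1] -/
theorem exists_h1ComparisonFamily_forall :
    ∀ {E : Type} [Field E] (τ' : E →+* ℂ) (ℓ : ℕ) [Fact ℓ.Prime] (ι : ℂ ≃+* AlgebraicClosure ℚ_[ℓ]),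
      exists_h1ComparisonFamily (E := E) τ' ℓ ι :=
  fun τ' ℓ _ ι ↦ exists_h1ComparisonFamily_holds τ' ℓ ι

end Literature.NumberTheory.Automorphic.Liu2021.AppendixC

end
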